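import Literature.NumberTheory.QuadraticFields.HeegnerCondition
import Literature.NumberTheory.QuadraticFields.SquareRootGenerator
import Mathlib.Algebra.QuadraticAlgebra.Basic
import Mathlib.NumberTheory.NumberField.Discriminant.Basic
import Mathlib.Algebra.Squarefree.Basic
import Mathlib.Data.Nat.Squarefree
import Mathlib.RingTheory.IntegralClosure.IntegrallyClosed
import HarnessLib

/-!
# Quadratic fields and fundamental discriminants: `d_K` is fundamental, and every fundamental
# discriminant is a `d_K`

Topic `NumberTheory/QuadraticFields`, namespace `Literature.NumberTheory.QuadraticFields.Quadratic`
(continuing `HeegnerCondition.lean`, `SquareRootGenerator.lean`, `KroneckerSplitting.lean`).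
Everything here is PROVED (theorems only). An integer `d` is a *fundamental discriminant* when
`d ≡ 1 (mod 4)` is squarefree and `≠ 1`, or `d = 4m` with `m ≡ 2, 3 (mod 4)` squarefree; we spell
this condition out as the disjunction
`(d % 4 = 1 ∧ Squarefree d ∧ d ≠ 1) ∨ (4 ∣ d ∧ (d / 4 % 4 = 2 ∨ d / 4 % 4 = 3) ∧ Squarefree (d / 4))`,
literally the body of `Literature.Barriers.RiemannHypothesis.IsFundamentalDiscriminant`
(`Barriers/RiemannHypothesis/EpsteinZetaRealZeros.lean`, whose analytic imports are not wanted
here). Results (Marcus, *Number Fields*, Ch. 2, Thm. 1 — "`d_K = m` if `m ≡ 1 (mod 4)` and `4m`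
otherwise, for `K = ℚ(√m)`, `m` squarefree" — obtained WITHOUT computing `𝓞 K`, from the integral
basis `(1, ω)` of `HeegnerCondition.lean`):

* `not_sq_dvd_discr_of_prime_ne_two` — no odd prime square divides `d_K`
  (`δ = 2ω − t`, `δ² = d_K`; `δ/p ∈ 𝓞 K` would have `ω`-coordinate `2/p`);
* `discr_div_four_emod_four` — if `4 ∣ d_K` then `d_K/4 ≡ 2, 3 (mod 4)`
  (`ω'² = d_K/4 = m'` for `ω' = ω − t/2`; `ω'/2`, resp. `(1 + ω')/2`, would be integral if
  `m' ≡ 0`, resp. `1 (mod 4)`);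
* `isFundamentalDiscriminant_discr` — **`d_K` is a fundamental discriminant** for every quadratic
  field `K` (with Stickelberger `d_K ≡ 0, 1 (mod 4)` from `HeegnerCondition.lean` and `|d_K| > 2`
  from Mathlib's Hermite–Minkowski theorem `NumberField.abs_discr_gt_two`);
* `eq_of_isFundamental_of_eq_mul_sq` — **uniqueness**: two fundamental discriminants differing by
  a rational square factor are equal;
* `exists_numberField_discr_eq` — **existence**: every fundamental discriminant `D` is `d_K` for
  the quadratic field `K = ℚ(√D)` (Mathlib's `QuadraticAlgebra ℚ D 0`), using
  `NumberField.exists_discr_eq_mul_sq` (`d_K = D q²`, `SquareRootGenerator.lean`) and uniqueness.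

Together: quadratic fields correspond to fundamental discriminants via `K ↦ d_K`, and (with
`IsImaginaryQuadratic ↔ d_K < 0`, `EllipticCurves/HeegnerPointsImaginaryQuadraticProofs.lean`)
imaginary quadratic fields to fundamental discriminants `D < 0` — the dictionary by which the
non-vanishing theorems for quadratic twists "for infinitely many fundamental discriminants `D < 0`"
(Ireland–Rosen §20.5, p. 354; Murty–Murty 1991, Cor. p. 449; Murty–Murty 1997, Ch. 6) are stated
over imaginary quadratic fields in `EllipticCurves/NonvanishingTwists.lean`. Mathlib has neither
the ring of integers nor the discriminant of a quadratic field (searched `QuadraticField`,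
`discr` under `NumberTheory/NumberField`: only `ℚ` and cyclotomic fields).

## References

* [Marcus2018] D. A. Marcus, *Number Fields*, 2nd ed. (2018), Ch. 2, Thm. 1 and Exercises 2.27–2.28.
* [Cox2013] D. A. Cox, *Primes of the form `x² + ny²`*, 2nd ed. (2013), §5.B and Ex. 5.13
  (fundamental discriminants = field discriminants of quadratic fields).
* [IrelandRosen1990] K. Ireland, M. Rosen, 2nd ed., §13.1 and §20.5 (p. 354).
-/

noncomputable section

open Module NumberField Polynomial

namespace Literature.NumberTheory.QuadraticFields.Quadratic

variable {K : Type*} [Field K] [NumberField K]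

/-! ### Integrality of square roots and the coordinate test -/

omit [NumberField K] in
/-- An element with integral square is integral (root of `X² − n`). [folklore] -/
theorem isIntegral_of_sq_eq_intCast {x : K} {n : ℤ} (hx : x ^ 2 = n) : IsIntegral ℤ x := by
  refine ⟨X ^ 2 - C n, ?_, ?_⟩
  · monicity!
  · simp only [eval₂_sub, eval₂_X_pow, eval₂_C]
    rw [hx]
    simp

omit [NumberField K] in
/-- An element `x` with `x² − x ∈ ℤ` is integral (root of `X² − X − n`). [folklore] -/
theorem isIntegral_of_sq_sub_eq_intCast {x : K} {n : ℤ} (hx : x ^ 2 - x = n) : IsIntegral ℤ x := by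
  refine ⟨X ^ 2 - X - C n, ?_, ?_⟩
  · monicity!
  · simp only [eval₂_sub, eval₂_X_pow, eval₂_X, eval₂_C]
    rw [hx]
    simp

omit [NumberField K] in
/-- **Coordinate test.** For a `ℤ`-basis `(1, ω)` of `𝓞 K`: if `k · y = a + c ω` with `y ∈ 𝓞 K`
and `k, a, c ∈ ℤ`, then `k ∣ c` (compare the `ω`-coordinates). [folklore] -/
theorem dvd_of_intCast_mul_eq (b : Basis (Fin 2) ℤ (𝓞 K)) (hb : b 0 = 1) {y : 𝓞 K} {k a c : ℤ}
    (h : (k : 𝓞 K) * y = (a : 𝓞 K) + (c : 𝓞 K) * b 1) : k ∣ c := by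
  have h1 : b.repr ((k : 𝓞 K) * y) 1 = k * b.repr y 1 := by
    rw [← zsmul_eq_mul, map_zsmul]
    simp
  have h2 : b.repr ((a : 𝓞 K) + (c : 𝓞 K) * b 1) 1 = c := by
    rw [show (a : 𝓞 K) = a • b 0 by rw [hb, zsmul_eq_mul, mul_one], ← zsmul_eq_mul, map_add,
      map_zsmul, map_zsmul, b.repr_self, b.repr_self]
    simp
  rw [h] at h1
  rw [h2] at h1
  exact ⟨_, h1⟩

omit [NumberField K] in
/-- An integral element of `K` lies in `𝓞 K` (as a subtype element). [folklore] -/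
theorem exists_coe_eq_of_isIntegral {x : K} (hx : IsIntegral ℤ x) : ∃ y : 𝓞 K, (y : K) = x :=
  ⟨⟨x, hx⟩, rfl⟩

/-! ### No odd prime square divides `d_K` -/

/-- **No odd square factor.** For a quadratic field `K` and an odd prime `p`, `p² ∤ d_K`: with an
integral basis `(1, ω)`, `ω² = m + tω`, `δ = 2ω − t` has `δ² = d_K`; if `p² ∣ d_K` then `δ/p` is
integral, `δ/p = a + cω` with `pc = 2`, impossible (Marcus, *Number Fields*, Ch. 2, Thm. 1 and
Ex. 2.27). [folklore] -/
theorem not_sq_dvd_discr_of_prime_ne_two (h2 : finrank ℚ K = 2) {p : ℕ} (hp : p.Prime)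
    (hp2 : p ≠ 2) : ¬ ((p : ℤ) ^ 2 ∣ NumberField.discr K) := by
  rintro ⟨e, he⟩
  obtain ⟨b, hb⟩ := exists_basis_zero_eq_one h2
  set t : ℤ := b.repr (b 1 * b 1) 1 with ht
  set m : ℤ := b.repr (b 1 * b 1) 0 with hm
  have hωω : b 1 * b 1 = (m : 𝓞 K) + (t : 𝓞 K) * b 1 := basis_one_mul_self_eq b hb
  have hd : NumberField.discr K = t ^ 2 + 4 * m := discr_eq_sq_add_four_mul b hb
  have hde : t ^ 2 + 4 * m = (p : ℤ) ^ 2 * e := hd.symm.trans he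
  -- `δ = 2ω − t`, `δ² = d_K = p² e`
  have h' : (2 * b 1 - (t : 𝓞 K)) ^ 2 = ((t ^ 2 + 4 * m : ℤ) : 𝓞 K) := by
    push_cast
    linear_combination (4 : 𝓞 K) * hωω
  have hδ2 : (algebraMap (𝓞 K) K (2 * b 1 - (t : 𝓞 K))) ^ 2 = (((p : ℤ) ^ 2 * e : ℤ) : K) := by
    rw [← map_pow, h', map_intCast, hde]
  -- `x = δ/p` has `x² = e`, hence is integral
  have hp0 : (p : K) ≠ 0 := by exact_mod_cast hp.ne_zero
  have hx2 : (algebraMap (𝓞 K) K (2 * b 1 - (t : 𝓞 K)) / p) ^ 2 = ((e : ℤ) : K) := by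
    rw [div_pow, hδ2]
    push_cast
    field_simp
  obtain ⟨y, hy⟩ := exists_coe_eq_of_isIntegral (isIntegral_of_sq_eq_intCast hx2)
  -- `p y = δ = −t + 2ω`, so `p ∣ 2`
  have hpy : ((p : ℤ) : 𝓞 K) * y = ((-t : ℤ) : 𝓞 K) + ((2 : ℤ) : 𝓞 K) * b 1 := by
    apply IsFractionRing.injective (𝓞 K) K
    rw [map_mul, map_intCast, show algebraMap (𝓞 K) K y = (y : K) from rfl, hy, Int.cast_natCast,
      mul_div_cancel₀ _ hp0, map_sub, map_add, map_mul, map_mul, map_intCast, map_intCast,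
      map_intCast, map_ofNat]
    push_cast
    ring
  have hdvd : (p : ℤ) ∣ 2 := dvd_of_intCast_mul_eq b hb hpy
  have hp2' : p ∣ 2 := by exact_mod_cast hdvd
  rcases (Nat.dvd_prime Nat.prime_two).mp hp2' with h1 | h1
  · exact hp.ne_one h1
  · exact hp2 h1

/-! ### The prime `2`: if `4 ∣ d_K` then `d_K / 4 ≡ 2, 3 (mod 4)` -/

/-- **The dyadic condition.** For a quadratic field `K` with `4 ∣ d_K`: `d_K/4 ≡ 2` or `3 (mod 4)`.
With an integral basis `(1, ω)`, `ω² = m + tω`, `d_K = t² + 4m`: `t = 2k` is even and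
`ω' = ω − k` has `ω'² = m' = d_K/4`; if `4 ∣ m'` then `ω'/2` is integral, and if `m' ≡ 1 (mod 4)`
then `(1 + ω')/2` is integral — in both cases an element of `𝓞 K` with `ω`-coordinate `1/2`
(Marcus, *Number Fields*, Ch. 2, Thm. 1). [folklore] -/
theorem discr_div_four_emod_four (h2 : finrank ℚ K = 2) (h4 : 4 ∣ NumberField.discr K) :
    NumberField.discr K / 4 % 4 = 2 ∨ NumberField.discr K / 4 % 4 = 3 := by
  obtain ⟨b, hb⟩ := exists_basis_zero_eq_one h2
  set t : ℤ := b.repr (b 1 * b 1) 1 with ht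
  set m : ℤ := b.repr (b 1 * b 1) 0 with hm
  have hωω : b 1 * b 1 = (m : 𝓞 K) + (t : 𝓞 K) * b 1 := basis_one_mul_self_eq b hb
  have hd : NumberField.discr K = t ^ 2 + 4 * m := discr_eq_sq_add_four_mul b hb
  -- `t = 2k` is even
  obtain ⟨k, hk⟩ : ∃ k, t = 2 * k := by
    obtain ⟨k, hk | hk⟩ := Int.even_or_odd' t
    · exact ⟨k, hk⟩
    · exfalso
      rw [hd, hk, show (2 * k + 1) ^ 2 + 4 * m = 4 * (k ^ 2 + k + m) + 1 by ring] at h4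
      omega
  -- `m' = d_K / 4 = k² + m` and `ω' = ω − k` has `ω'² = m'`
  have hm' : NumberField.discr K / 4 = k ^ 2 + m := by
    rw [hd, hk, show (2 * k) ^ 2 + 4 * m = 4 * (k ^ 2 + m) by ring]
    exact Int.mul_ediv_cancel_left _ four_ne_zero
  have hω' : (b 1 - (k : 𝓞 K)) ^ 2 = ((k ^ 2 + m : ℤ) : 𝓞 K) := by
    have hk' : (t : 𝓞 K) = 2 * (k : 𝓞 K) := by rw [hk]; push_cast; ring
    push_cast
    linear_combination hωω + b 1 * hk'
  have h20 : (2 : K) ≠ 0 := two_ne_zero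
  rw [hm']
  -- exclude `m' ≡ 0 (mod 4)`: `ω'/2` would be integral
  have h0 : (k ^ 2 + m) % 4 ≠ 0 := by
    intro h0
    obtain ⟨e, he⟩ : (4 : ℤ) ∣ k ^ 2 + m := Int.dvd_of_emod_eq_zero h0
    have hx2 : (algebraMap (𝓞 K) K (b 1 - (k : 𝓞 K)) / 2) ^ 2 = ((e : ℤ) : K) := by
      rw [div_pow, ← map_pow, hω', map_intCast, he]
      push_cast
      ring
    obtain ⟨y, hy⟩ := exists_coe_eq_of_isIntegral (isIntegral_of_sq_eq_intCast hx2)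
    have h2y : ((2 : ℤ) : 𝓞 K) * y = ((-k : ℤ) : 𝓞 K) + ((1 : ℤ) : 𝓞 K) * b 1 := by
      apply IsFractionRing.injective (𝓞 K) K
      rw [map_mul, map_intCast, show algebraMap (𝓞 K) K y = (y : K) from rfl, hy, Int.cast_ofNat,
        mul_div_cancel₀ _ h20, map_sub, map_add, map_mul, map_intCast, map_intCast, map_intCast]
      push_cast
      ring
    have := dvd_of_intCast_mul_eq b hb h2y
    omega
  -- exclude `m' ≡ 1 (mod 4)`: `(1 + ω')/2` would be integral
  have h1 : (k ^ 2 + m) % 4 ≠ 1 := by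
    intro h1
    obtain ⟨e, he⟩ : (4 : ℤ) ∣ k ^ 2 + m - 1 := Int.dvd_of_emod_eq_zero (by omega)
    have hx2 : ((algebraMap (𝓞 K) K (b 1 - (k : 𝓞 K)) + 1) / 2) ^ 2
        - (algebraMap (𝓞 K) K (b 1 - (k : 𝓞 K)) + 1) / 2 = ((e : ℤ) : K) := by
      have hsq : (algebraMap (𝓞 K) K (b 1 - (k : 𝓞 K))) ^ 2 = ((k ^ 2 + m : ℤ) : K) := by
        rw [← map_pow, hω', map_intCast]
      have he' : ((k ^ 2 + m : ℤ) : K) = 4 * (e : K) + 1 := by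
        rw [show k ^ 2 + m = 4 * e + 1 by omega]
        push_cast
        ring
      field_simp
      linear_combination hsq + he'
    obtain ⟨y, hy⟩ := exists_coe_eq_of_isIntegral (isIntegral_of_sq_sub_eq_intCast hx2)
    have h2y : ((2 : ℤ) : 𝓞 K) * y = ((1 - k : ℤ) : 𝓞 K) + ((1 : ℤ) : 𝓞 K) * b 1 := by
      apply IsFractionRing.injective (𝓞 K) K
      rw [map_mul, map_intCast, show algebraMap (𝓞 K) K y = (y : K) from rfl, hy, Int.cast_ofNat,
        mul_div_cancel₀ _ h20, map_sub, map_add, map_mul, map_intCast, map_intCast, map_intCast]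
      push_cast
      ring
    have := dvd_of_intCast_mul_eq b hb h2y
    omega
  omega

/-! ### `d_K` is a fundamental discriminant -/

/-- An integer none of whose prime squares divide it is squarefree (bridge to
`Nat.squarefree_iff_prime_squarefree`). [folklore] -/
theorem _root_.Int.squarefree_of_forall_prime_sq_not_dvd {d : ℤ}
    (h : ∀ p : ℕ, p.Prime → ¬ ((p : ℤ) ^ 2 ∣ d)) : Squarefree d := by
  rw [← Int.squarefree_natAbs, Nat.squarefree_iff_prime_squarefree]
  intro q hq hdvd
  refine h q hq ?_
  rw [sq, ← Nat.cast_mul]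
  exact Int.natCast_dvd.mpr hdvd

/-- **The discriminant of a quadratic field is a fundamental discriminant**: either
`d_K ≡ 1 (mod 4)` is squarefree (and `≠ 1`), or `d_K = 4m` with `m ≡ 2, 3 (mod 4)` squarefree
(Marcus, *Number Fields*, Ch. 2, Thm. 1: `d_K = m` or `4m` for `K = ℚ(√m)`, `m` squarefree;
Cohen, *A Course in Computational Algebraic Number Theory*, Def. 5.1.2). The shape of the statement
is literally that of `Literature.Barriers.RiemannHypothesis.IsFundamentalDiscriminant (discr K)`
(file `Barriers/RiemannHypothesis/EpsteinZetaRealZeros.lean`, not imported here). Proof: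
Stickelberger `d_K ≡ 0, 1 (mod 4)` (`discr_emod_four`), no odd square factor
(`not_sq_dvd_discr_of_prime_ne_two`), the dyadic condition (`discr_div_four_emod_four`), and
`|d_K| > 2` (Mathlib's Hermite–Minkowski `NumberField.abs_discr_gt_two`). [folklore] -/
theorem isFundamentalDiscriminant_discr (h2 : finrank ℚ K = 2) :
    (NumberField.discr K % 4 = 1 ∧ Squarefree (NumberField.discr K) ∧ NumberField.discr K ≠ 1) ∨
      (4 ∣ NumberField.discr K ∧
        (NumberField.discr K / 4 % 4 = 2 ∨ NumberField.discr K / 4 % 4 = 3) ∧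
          Squarefree (NumberField.discr K / 4)) := by
  have hgt : 2 < |NumberField.discr K| := NumberField.abs_discr_gt_two (by rw [h2]; exact one_lt_two)
  rcases discr_emod_four (K := K) h2 with h0 | h1
  · right
    have h4 : 4 ∣ NumberField.discr K := Int.dvd_of_emod_eq_zero h0
    have hm := discr_div_four_emod_four h2 h4
    refine ⟨h4, hm, Int.squarefree_of_forall_prime_sq_not_dvd fun p hp hdvd => ?_⟩
    by_cases hp2 : p = 2
    · subst hp2
      omega
    · obtain ⟨e, he⟩ := hdvd
      refine not_sq_dvd_discr_of_prime_ne_two h2 hp hp2 ⟨4 * e, ?_⟩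
      rw [← Int.ediv_mul_cancel h4, he]
      ring
  · left
    refine ⟨h1, Int.squarefree_of_forall_prime_sq_not_dvd fun p hp hdvd => ?_, fun h => ?_⟩
    · by_cases hp2 : p = 2
      · subst hp2
        omega
      · exact not_sq_dvd_discr_of_prime_ne_two h2 hp hp2 hdvd
    · rw [h] at hgt
      norm_num at hgt

/-! ### Fundamental discriminants differing by a rational square are equal -/

/-- A square dividing a fundamental discriminant is `1` or `4`: if `d ≡ 1 (mod 4)` is squarefree
then `x² ∣ d` forces `x = ±1`; if `d = 4m` with `m` squarefree then `x² ∣ 4m` gives `x² ∣ m`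
(`x` odd) or `(x/2)² ∣ m` (`x` even). [folklore] -/
theorem sq_eq_one_or_four_of_sq_dvd {d x : ℤ}
    (hd : (d % 4 = 1 ∧ Squarefree d ∧ d ≠ 1) ∨
      (4 ∣ d ∧ (d / 4 % 4 = 2 ∨ d / 4 % 4 = 3) ∧ Squarefree (d / 4)))
    (hx : x ^ 2 ∣ d) : x ^ 2 = 1 ∨ x ^ 2 = 4 := by
  rcases hd with ⟨-, hsq, -⟩ | ⟨h4, -, hsq⟩
  · left
    have hu : IsUnit x := hsq x (by rwa [← sq])
    rcases Int.isUnit_iff.mp hu with rfl | rfl <;> norm_num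
  · set m := d / 4 with hm
    have hdm : d = 4 * m := by rw [hm, Int.mul_ediv_cancel' h4]
    rw [hdm] at hx
    obtain ⟨k, rfl | rfl⟩ := Int.even_or_odd' x
    · -- `x = 2k`: `k² ∣ m`, so `k = ±1` and `x² = 4`
      right
      have hk : k ^ 2 ∣ m := by
        rw [show (2 * k) ^ 2 = 4 * k ^ 2 by ring] at hx
        exact (mul_dvd_mul_iff_left four_ne_zero).mp hx
      have hu : IsUnit k := hsq k (by rwa [← sq])
      rcases Int.isUnit_iff.mp hu with rfl | rfl <;> norm_num
    · -- `x = 2k + 1` odd: `x² ∣ m`, so `x = ±1`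
      left
      have hcop : IsCoprime ((2 * k + 1) ^ 2) ((2 : ℤ) ^ 2) :=
        (show IsCoprime (2 * k + 1) (2 : ℤ) from ⟨1, -k, by ring⟩).pow
      have hk : (2 * k + 1) ^ 2 ∣ m := hcop.dvd_of_dvd_mul_left (by rw [show (2 : ℤ) ^ 2 = 4 by norm_num]; exact hx)
      have hu : IsUnit (2 * k + 1) := hsq (2 * k + 1) (by rwa [← sq])
      rcases Int.isUnit_iff.mp hu with h1 | h1 <;> rw [h1] <;> norm_num

/-- `d` and `4d` are not both fundamental discriminants. [folklore] -/
theorem ne_four_mul_of_isFundamental {d₁ d₂ : ℤ}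
    (h₁ : (d₁ % 4 = 1 ∧ Squarefree d₁ ∧ d₁ ≠ 1) ∨
      (4 ∣ d₁ ∧ (d₁ / 4 % 4 = 2 ∨ d₁ / 4 % 4 = 3) ∧ Squarefree (d₁ / 4)))
    (h₂ : (d₂ % 4 = 1 ∧ Squarefree d₂ ∧ d₂ ≠ 1) ∨
      (4 ∣ d₂ ∧ (d₂ / 4 % 4 = 2 ∨ d₂ / 4 % 4 = 3) ∧ Squarefree (d₂ / 4))) :
    d₁ ≠ 4 * d₂ := by
  rintro rfl
  rcases h₁ with ⟨h1, -, -⟩ | ⟨-, hm4, -⟩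
  · omega
  · rw [Int.mul_ediv_cancel_left _ four_ne_zero] at hm4
    rcases h₂ with ⟨h1', -, -⟩ | ⟨h4', -, -⟩ <;> omega

/-- **Uniqueness.** Two fundamental discriminants that differ by the square of a rational number
are equal (so the fundamental discriminant `d_K` determines and is determined by the quadratic
field `K = ℚ(√d_K)`). Proof: clearing denominators, `d₁ b² = d₂ a²` with `(a, b) = 1`, so
`a² ∣ d₁` and `b² ∣ d₂`, whence `a², b² ∈ {1, 4}` (`sq_eq_one_or_four_of_sq_dvd`), not both `4`;
and `d₁ = 4d₂`, `4d₁ = d₂` are excluded (`ne_four_mul_of_isFundamental`). [folklore] -/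
theorem eq_of_isFundamental_of_eq_mul_sq {d₁ d₂ : ℤ}
    (h₁ : (d₁ % 4 = 1 ∧ Squarefree d₁ ∧ d₁ ≠ 1) ∨
      (4 ∣ d₁ ∧ (d₁ / 4 % 4 = 2 ∨ d₁ / 4 % 4 = 3) ∧ Squarefree (d₁ / 4)))
    (h₂ : (d₂ % 4 = 1 ∧ Squarefree d₂ ∧ d₂ ≠ 1) ∨
      (4 ∣ d₂ ∧ (d₂ / 4 % 4 = 2 ∨ d₂ / 4 % 4 = 3) ∧ Squarefree (d₂ / 4)))
    {q : ℚ} (hq : (d₁ : ℚ) = d₂ * q ^ 2) : d₁ = d₂ := by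
  -- clear denominators: `d₁ den² = d₂ num²`
  have key' : (d₁ : ℚ) * (q.den : ℚ) ^ 2 = d₂ * (q.num : ℚ) ^ 2 := by
    rw [hq, ← Rat.mul_den_eq_num]
    ring
  have key : d₁ * (q.den : ℤ) ^ 2 = d₂ * q.num ^ 2 := by exact_mod_cast key'
  have hcop : IsCoprime q.num (q.den : ℤ) :=
    Int.isCoprime_iff_nat_coprime.mpr (by simpa using q.reduced)
  have ha : q.num ^ 2 ∣ d₁ :=
    hcop.pow.dvd_of_dvd_mul_right ⟨d₂, by rw [key]; ring⟩
  have hb : (q.den : ℤ) ^ 2 ∣ d₂ :=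
    hcop.symm.pow.dvd_of_dvd_mul_right ⟨d₁, by rw [← key]; ring⟩
  rcases sq_eq_one_or_four_of_sq_dvd h₁ ha with ha1 | ha4 <;>
    rcases sq_eq_one_or_four_of_sq_dvd h₂ hb with hb1 | hb4
  · rw [ha1, hb1] at key
    linarith
  · rw [ha1, hb4] at key
    exact absurd (by linarith : d₂ = 4 * d₁) (ne_four_mul_of_isFundamental h₂ h₁)
  · rw [ha4, hb1] at key
    exact absurd (by linarith : d₁ = 4 * d₂) (ne_four_mul_of_isFundamental h₁ h₂)
  · -- `2 ∣ num` and `2 ∣ den`: contradicts `(num, den) = 1`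
    exfalso
    have h4 : IsCoprime (q.num ^ 2) ((q.den : ℤ) ^ 2) := hcop.pow
    rw [ha4, hb4] at h4
    have := Int.isCoprime_iff_gcd_eq_one.mp h4
    norm_num at this

/-! ### Every fundamental discriminant is the discriminant of a quadratic field -/

/-- **Existence.** Every fundamental discriminant `D` is the discriminant of a quadratic field,
namely of `K = ℚ(√D)` (Mathlib's `QuadraticAlgebra ℚ D 0`, a field since `D` is not a rational
square): `d_K = D q²` for some rational `q` (`NumberField.exists_discr_eq_mul_sq`,
`SquareRootGenerator.lean`), `d_K` is fundamental (`isFundamentalDiscriminant_discr`), hence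
`d_K = D` (`eq_of_isFundamental_of_eq_mul_sq`). With `isFundamentalDiscriminant_discr` this is
the classical bijection "quadratic fields ↔ fundamental discriminants" (Marcus, *Number Fields*,
Ch. 2, Thm. 1; Cohen, *A Course in Computational Algebraic Number Theory*, §5.1), e.g. "imaginary
quadratic fields ↔ fundamental discriminants `D < 0`" as used in the statements of
`Literature/NumberTheory/EllipticCurves/NonvanishingTwists.lean`. [folklore] -/
theorem exists_numberField_discr_eq {D : ℤ}
    (hD : (D % 4 = 1 ∧ Squarefree D ∧ D ≠ 1) ∨
      (4 ∣ D ∧ (D / 4 % 4 = 2 ∨ D / 4 % 4 = 3) ∧ Squarefree (D / 4))) :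
    ∃ (K : Type) (_ : Field K) (_ : NumberField K),
      Module.finrank ℚ K = 2 ∧ NumberField.discr K = D := by
  -- `D` is not a square in `ℚ`: a rational square root is an integer `n`, and `n² = D` is a square
  -- dividing the fundamental discriminant `D`, so `D ∈ {1, 4}`, both excluded
  have hns : ∀ r : ℚ, r ^ 2 ≠ (D : ℚ) := by
    intro r hr
    have hint : IsIntegral ℤ r := by
      refine ⟨X ^ 2 - C D, by monicity!, ?_⟩
      simp only [eval₂_sub, eval₂_X_pow, eval₂_C]
      rw [hr]
      simp
    obtain ⟨n, hn⟩ := IsIntegrallyClosed.isIntegral_iff.mp hint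
    rw [← hn, eq_intCast] at hr
    have hD' : n ^ 2 = D := by exact_mod_cast hr
    rcases sq_eq_one_or_four_of_sq_dvd hD ⟨1, by rw [hD', mul_one]⟩ with h1 | h4
    · rcases hD with ⟨-, -, hne⟩ | ⟨h4, -, -⟩
      · exact hne (by rw [← hD', h1])
      · rw [← hD', h1] at h4
        norm_num at h4
    · rcases hD with ⟨h1, -, -⟩ | ⟨-, hm4, -⟩
      · rw [← hD', h4] at h1
        norm_num at h1
      · rw [← hD', h4] at hm4
        norm_num at hm4
  haveI : Fact (∀ r : ℚ, r ^ 2 ≠ (D : ℚ) + 0 * r) := ⟨fun r h => hns r (by rw [h]; ring)⟩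
  let L := QuadraticAlgebra ℚ (D : ℚ) 0
  haveI : NumberField L := NumberField.of_module_finite ℚ L
  have h2L : Module.finrank ℚ L = 2 := by convert QuadraticAlgebra.finrank_eq_two (D : ℚ) (0 : ℚ)
  -- `ω² = D`, `ω ∉ ℚ`
  have hω : (QuadraticAlgebra.omega : L) ^ 2 = algebraMap ℚ L (D : ℚ) := by
    have h := QuadraticAlgebra.omega_mul_omega_eq_add (a := (D : ℚ)) (b := (0 : ℚ))
    rw [zero_smul, add_zero] at h
    rw [sq, h, Algebra.algebraMap_eq_smul_one]
  have hωK : (QuadraticAlgebra.omega : L) ∉ Set.range (algebraMap ℚ L) := by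
    rintro ⟨r, h⟩
    have him := congrArg QuadraticAlgebra.im h
    rw [QuadraticAlgebra.omega_im] at him
    have : (algebraMap ℚ L r).im = 0 := by
      rw [show algebraMap ℚ L r = (r : L) from rfl]
      rfl
    rw [this] at him
    exact zero_ne_one him
  obtain ⟨q, -, hq⟩ := NumberField.exists_discr_eq_mul_sq h2L hωK hω
  exact ⟨L, inferInstance, inferInstance, h2L,
    eq_of_isFundamental_of_eq_mul_sq (isFundamentalDiscriminant_discr h2L) hD hq⟩

end Literature.NumberTheory.QuadraticFields.Quadratic

end
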